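import Mathlib
import HarnessLib
import Summits.RiemannHypothesis.RiemannHypothesis.Theses.WeilParity
import Summits.RiemannHypothesis.RiemannHypothesis.Theorems.WeilGroundStateGroundStateSimpleEvenCellTransfer
import Summits.RiemannHypothesis.RiemannHypothesis.Theorems.WeilGroundStateGroundStateSimpleEvenTrialUpperA
import Summits.RiemannHypothesis.RiemannHypothesis.Theorems.WeilGroundStateGroundStateSimpleEvenTrialUpperB
import Summits.RiemannHypothesis.RiemannHypothesis.Theorems.WeilGroundStateGroundStateSimpleEvenTrialUpperC
import Summits.RiemannHypothesis.RiemannHypothesis.Theorems.WeilGroundStateGroundStateSimpleEvenTrialUpperD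
import Summits.RiemannHypothesis.RiemannHypothesis.Theorems.WeilGroundStateGroundStateSimpleEvenOddLowerA
import Summits.RiemannHypothesis.RiemannHypothesis.Theorems.WeilGroundStateGroundStateSimpleEvenOddLowerB
import Summits.RiemannHypothesis.RiemannHypothesis.Theorems.WeilGroundStateGroundStateSimpleEvenOddLowerC
import Summits.RiemannHypothesis.RiemannHypothesis.Theorems.WeilGroundStateGroundStateSimpleEvenOddLowerD

/-!
# Crux `EvenWinsBeyondArch` (stmt-RiemannHypothesis-15432), line `split`: stub 1 —
# the one-prime parity theorem from the sister line's eight certified cell bounds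

`stub_onePrimeWindowSimpleEven` (registered on stmt-RiemannHypothesis-15432; = route item 18084
`OnePrimeWindowSimpleEven` verbatim): on every window `(log 2)/2 < a ≤ (log 3)/2` the bottom of Weil's
windowed form is simple, isolated and even (`WeilWindowSimpleEven a`).  RH-free.  Composition of the
landed cell transfer `GroundStateSimpleEven.weilWindowSimpleEven_on_cell_of_le` over the grid
`11/32 < 2/5 < 23/50 < 51/100 < (log 3)/2` with the sister crux `GroundStateSimpleEven`'s landed cell
bounds: even Rayleigh–Ritz upper bounds `stub_trialUpperA–D` (`ε(11/32) ≤ 53/10000`, `ε(2/5) ≤ 3/10000`,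
`ε(23/50) ≤ 15/10⁶`, `ε(51/100) ≤ 17/(5·10⁶)`) at the left ends and odd-sector margin certificates
`stub_oddLowerA–D` (odd normalised tests have `Re Q ≥ 1/100, 1/1000, 6/10⁵, 6/10⁶` on the windows
`2/5, 23/50, 51/100, (log 3)/2` — Stage-C `WeilCert3` odd block with lowered Bessel coefficient) at the
right ends (the composition of the sister skeleton's `stub_firstPrimeWindows`, verbatim).
-/

namespace Summit.RiemannHypothesis.RiemannHypothesis.Theorems

open Literature.NumberTheory.LFunctions

/-- **Stub 1 of line `split` of crux `EvenWinsBeyondArch`** — the ONE-PRIME PARITY THEOREM: for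
`(log 2)/2 < a ≤ (log 3)/2`, `WeilWindowSimpleEven a`. [cite: ConnesSuijlekom2025, Thm. 6.1 (hypothesis); Yoshida1992, Thm 1 (method); certificates in-tree] -/
theorem stub_onePrimeWindowSimpleEven :
    ∀ a : ℝ, Real.log 2 / 2 < a → a ≤ Real.log 3 / 2 →
      Literature.NumberTheory.LFunctions.WeilWindowSimpleEven a := by
  intro a hlo hhi
  have hl2 := Real.log_two_gt_d9
  rcases le_or_gt a (2 / 5) with h1 | h1
  · exact GroundStateSimpleEven.weilWindowSimpleEven_on_cell_of_le
      (b := 11 / 32) (c := 2 / 5) (U := 53 / 10000) (L := 1 / 100) (by norm_num) (by norm_num)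
      stub_trialUpperA (fun g hg hs hn ho ↦ stub_oddLowerA g hg hs hn ho) (by linarith) h1
  rcases le_or_gt a (23 / 50) with h2 | h2
  · exact GroundStateSimpleEven.weilWindowSimpleEven_on_cell_of_le
      (b := 2 / 5) (c := 23 / 50) (U := 3 / 10000) (L := 1 / 1000) (by norm_num) (by norm_num)
      stub_trialUpperB (fun g hg hs hn ho ↦ stub_oddLowerB g hg hs hn ho) h1.le h2
  rcases le_or_gt a (51 / 100) with h3 | h3
  · exact GroundStateSimpleEven.weilWindowSimpleEven_on_cell_of_le
      (b := 23 / 50) (c := 51 / 100) (U := 15 / 1000000) (L := 6 / 100000) (by norm_num) (by norm_num)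
      stub_trialUpperC (fun g hg hs hn ho ↦ stub_oddLowerC g hg hs hn ho) h2.le h3
  · exact GroundStateSimpleEven.weilWindowSimpleEven_on_cell_of_le
      (b := 51 / 100) (c := Real.log 3 / 2) (U := 17 / 5000000) (L := 6 / 1000000) (by norm_num)
      (by norm_num) stub_trialUpperD (fun g hg hs hn ho ↦ stub_oddLowerD g hg hs hn ho) h3.le hhi

end Summit.RiemannHypothesis.RiemannHypothesis.Theorems
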